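import Literature.Topology.FourManifolds.GompfFramedTwistTransport
import Literature.Topology.FourManifolds.CappellShanesonDeltaMove
import HarnessLib

/-!
# The model of the fishtail end and Gompf's base rotation as a fibrewise re-gluing

Infrastructure for the geometric core of R. Gompf, *More Cappell–Shaneson spheres are standard*,
Algebr. Geom. Topol. 10 (2010), **Lemma 2.2** (the multiplicity-one logarithmic transformation on a
fishtail neighbourhood `Φ = N ∪_γ (2-handle)` does not change the 4-manifold) as used in the proof
of Theorem 2.1. Gompf's proof of the lemma: "Interpret `∂N` as the trivial `∂D² × S¹`-bundle over
the middle factor of `N` … Adding the 2-handle to `N` changes the boundary by `±1`-surgery on `γ`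
… changing the bundle monodromy on `∂D² × S¹` to a Dehn twist `ψ` along `γ`. Thus we have
identified `∂Φ` with the bundle `ℝ × T²/(t, x) ∼ (t - 1, ψ(x))`. The gluing diffeomorphism on
`∂Φ` … is … `ψ` on each fiber. To extend this over `Φ`, work in a collar `I × ∂Φ` … Then the
diffeomorphism `(s, t, x) ↦ (s, s + t, x)` is the required one for `s = 1` and the identity for
`s = 0`." So the end of `Φ` is `∂Φ × (collar)` with `∂Φ` the mapping torus of a Dehn twist of
`T²`, and Gompf's diffeomorphism rotates the base circle by an amount depending on the depth in
the collar.

This file builds an explicit model of that end inside the tree's glued mapping tori and realises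
the base rotation there. The 3-manifold `∂Φ` (a `T²`-bundle over `S¹` with Dehn-twist monodromy,
equivalently the circle bundle of Euler number one over `T²`) is presented as a mapping torus
**over the other base circle**: writing the fibre coordinates of `T³ = 𝕊¹ × 𝕊¹ × 𝕊¹` as
`(z₁, z₂, z₃) = (e^{ie}, e^{in}, e^{iℓ})` — `e` the depth in the collar (an extra circle factor,
of which only an arc is used), `n` Gompf's base coordinate (the middle factor of `N`), `ℓ` the
direction of `γ` — the model is the glued mapping torus `MTorus Ψ` (base coordinate the angle
around the `D²`-factor of `N`) of the **shear twist**
`Ψ (z₁, z₂, z₃) = (z₁, z₂, z₃ · e^{i g(arg z₂)})` (`Literature.Topology.FourManifolds.fishMonodromy`),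
`g = gompfLift a′ b′` a smooth degree-one staircase: a Dehn twist of the fibre `T²_{(n, ℓ)}` along
the circle of `γ`, the identity off the step of `g` (so that away from the position of the
2-handle the model is the honest product `∂N × (collar)`). In this presentation Gompf's rotation
of the base circle `n` is a **fibrewise** diffeomorphism, and fibrewise re-gluings of glued
mapping tori are available in the tree (uniqueness of open gluings with witnesses, as for
`isotopyTransport`):

* `Literature.Topology.FourManifolds.shearTwist`, `Literature.Topology.FourManifolds.fishMonodromy`;
* `Literature.Topology.FourManifolds.fishStair a b` — a smooth `κ` with two unit steps, at `[a, b]`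
  and `[1 + a, 1 + b]` (`0 < a < b < 1/2`), so that `κ (s + 1) = κ s + 1` on the monodromy overlap
  `s ∈ (0, 1/2)`;
* `Literature.Topology.FourManifolds.contMDiff_circleMapOfLift_param` — smooth multi-parameter
  families of circle maps from smooth families of lifts (the tree's
  `contMDiff_circleMapOfLift_uncurry` with an arbitrary normed parameter space);
* `Literature.Topology.FourManifolds.fishTurn g κ c` — **the turn**
  `(z₁, z₂, z₃) ↦ (z₁, z₂ e^{ic}, z₃ e^{iκ (g(arg z₂ + c) - g(arg z₂))})`: rotation of Gompf's base
  circle by `c` together with the shear that makes it compatible with the monodromy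
  (`fishTurn_fishMonodromy`: `F_{κ+1} ∘ Ψ = Ψ ∘ F_κ`); its inverse is the turn by `-c`
  (`fishTurn_neg_fishTurn`); for `c = 0` it is the identity and for `c = 2π` it is the
  **sliver twist** `(z₁, z₂, z₃) ↦ (z₁, z₂, z₃ e^{2πiκ})` (`fishTurn_two_pi`);
* `Literature.Topology.FourManifolds.FishParams` (the parameters: band, step arc, turn profile),
  `FishParams.twistOne`, `FishParams.twistTwo` — the re-gluing diffeomorphisms `(x, s) ↦ (F_{κ(s), c(x)} x, s)` of the two cylinders, the turn
  angle `c = u (z₁)` an arbitrary smooth function of the depth, and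
  `FishParams.isOpenGluingWith_mTorus_twist`: they form an open gluing of `MTorus Ψ` along its own
  relation;
* `Literature.Topology.FourManifolds.FishParams.baseTurn` — **Gompf's diffeomorphism of the model end**:
  `R : MTorus Ψ ≃ₘ MTorus Ψ` with `R [x, s] = [F_{κ(s), u(z₁(x))} x, s]` on both cylinders
  (`baseTurn_inl`, `baseTurn_inr`); the identity on the fibres where `u = 0` (`baseTurn_inl_of_eq_zero`)
  and the sliver twist `[x, s] ↦ [(z₁, z₂, z₃ e^{2πi κ(s)}), s]` — the identity except over the base
  band `(a, b)`, where it rotates the `γ`-circle once — on the fibres where `u = 2π`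
  (`baseTurn_inl_of_eq_two_pi`).

Everything is proved; no named facts are introduced. The identification of the end of an actual
fishtail neighbourhood with (an open subset of) this model — where the disc and its framing
enter — is not part of this file.

## References

* R. E. Gompf, *More Cappell–Shaneson spheres are standard*, Algebr. Geom. Topol. 10 (2010)
  1665–1681: Lemma 2.2 and its proof; proof of Thm 2.1, last paragraph. [GompfAGT2010]
-/

open scoped Manifold ContDiff Topology Real
open Set Function Metric Complex

noncomputable section

namespace Literature.Topology.FourManifolds

universe u

/-- Local notation: `𝔼 n` is the model Euclidean space `EuclideanSpace ℝ (Fin n)`. -/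
local notation "𝔼 " n:arg => EuclideanSpace ℝ (Fin n)

/-- Local notation: the model with corners `𝓣 = (𝓡 1).prod ((𝓡 1).prod (𝓡 1))` of `ThreeTorus`. -/
local notation "𝓣" =>
  (ModelWithCorners.prod (𝓡 1) (ModelWithCorners.prod (𝓡 1) (𝓡 1)))

attribute [local instance] finrank_real_complex_fact'

/-! ### Smooth multi-parameter families of circle maps -/

section Param

variable {P : Type*} [NormedAddCommGroup P] [NormedSpace ℝ P]

/-- **Smooth families of circle maps from smooth families of lifts, with parameters in a normed
space `P`**: if `Φ : P × ℝ → ℝ` is `C^∞` and each `Φ p` is a lift of degree `k`, then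
`(p, z) ↦ circleMapOfLift (Φ p) z` is `C^∞` on `P × 𝕊¹` (two charts of the circle, as in
`contMDiff_circleMapOfLift_uncurry`). [folklore] -/
theorem contMDiff_circleMapOfLift_param {Φ : P → ℝ → ℝ} {k : ℤ}
    (hΦ : ContDiff ℝ ∞ (uncurry Φ)) (hper : ∀ p θ, Φ p (θ + 2 * π) = Φ p θ + 2 * π * k) :
    ContMDiff (𝓘(ℝ, P).prod (𝓡 1)) (𝓡 1) ∞ fun q : P × Circle ↦ circleMapOfLift (Φ q.1) q.2 := by
  intro q
  rcases mem_slitPlane_or_neg_mem_slitPlane q.2 with hz | hz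
  · have h1 : ContMDiffAt (𝓘(ℝ, P).prod (𝓡 1)) 𝓘(ℝ, P × ℝ) ∞
        (fun q : P × Circle ↦ (q.1, Complex.arg (q.2 : ℂ))) q :=
      contMDiffAt_fst.prodMk_space ((contMDiffAt_arg_circle hz).comp q contMDiffAt_snd)
    exact contMDiff_circleExp.contMDiffAt.comp q (hΦ.contDiffAt.comp_contMDiffAt h1)
  · have heq : (fun q : P × Circle ↦ circleMapOfLift (Φ q.1) q.2) =
        fun q ↦ Circle.exp (Φ q.1 (Complex.arg (-(q.2 : ℂ)) + π)) :=
      funext fun q ↦ circleMapOfLift_eq_exp_arg_neg (hper q.1) q.2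
    rw [heq]
    have h1 : ContMDiffAt (𝓘(ℝ, P).prod (𝓡 1)) 𝓘(ℝ, P × ℝ) ∞
        (fun q : P × Circle ↦ (q.1, Complex.arg (-(q.2 : ℂ)) + π)) q :=
      contMDiffAt_fst.prodMk_space ((contMDiffAt_arg_neg_circle hz).comp q contMDiffAt_snd)
    exact contMDiff_circleExp.contMDiffAt.comp q (hΦ.contDiffAt.comp_contMDiffAt h1)

end Param

/-! ### Shear twists of `T³` and the fishtail monodromy -/

section Shear

/-- **Shear twist**: `(z₁, z₂, z₃) ↦ (z₁, z₂, z₃ · F z₂)` — the last coordinate rotated by an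
amount depending on the middle one. [folklore] -/
def shearTwist (F : Circle → Circle) (z : ThreeTorus) : ThreeTorus :=
  (z.1, z.2.1, z.2.2 * F z.2.1)

/-- First coordinate of a shear twist. [folklore] -/
@[simp] theorem shearTwist_fst (F : Circle → Circle) (z : ThreeTorus) : (shearTwist F z).1 = z.1 := rfl

/-- Second coordinate of a shear twist. [folklore] -/
@[simp] theorem shearTwist_snd_fst (F : Circle → Circle) (z : ThreeTorus) :
    (shearTwist F z).2.1 = z.2.1 := rfl

/-- Third coordinate of a shear twist. [folklore] -/
@[simp] theorem shearTwist_snd_snd (F : Circle → Circle) (z : ThreeTorus) :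
    (shearTwist F z).2.2 = z.2.2 * F z.2.1 := rfl

/-- Shear twists compose by multiplying the circle maps. [folklore] -/
theorem shearTwist_shearTwist (F G : Circle → Circle) (z : ThreeTorus) :
    shearTwist F (shearTwist G z) = shearTwist (fun w ↦ F w * G w) z := by
  obtain ⟨a, b, c⟩ := z
  simp only [shearTwist, mul_assoc, mul_comm (G b) (F b)]

/-- The shear twist by the constant map `1` is the identity. [folklore] -/
theorem shearTwist_one : shearTwist (fun _ ↦ (1 : Circle)) = id := by
  funext z
  simp [shearTwist]

/-- Shear twists by smooth circle maps are smooth. [folklore] -/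
theorem contMDiff_shearTwist {F : Circle → Circle} (hF : ContMDiff (𝓡 1) (𝓡 1) ∞ F) :
    ContMDiff 𝓣 𝓣 ∞ (shearTwist F) := by
  have h2 : ContMDiff 𝓣 (𝓡 1) ∞ fun z : ThreeTorus ↦ F z.2.1 :=
    hF.comp (contMDiff_fst.comp contMDiff_snd)
  exact contMDiff_fst.prodMk ((contMDiff_fst.comp contMDiff_snd).prodMk
    ((contMDiff_snd.comp contMDiff_snd).mul h2))

/-- **The shear twist by a smooth circle map, as a diffeomorphism of `T³`.** [folklore] -/
def shearTwistDiffeo (F : Circle → Circle) (hF : ContMDiff (𝓡 1) (𝓡 1) ∞ F) :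
    ThreeTorus ≃ₘ⟮𝓣, 𝓣⟯ ThreeTorus where
  toFun := shearTwist F
  invFun := shearTwist fun w ↦ (F w)⁻¹
  left_inv z := by rw [shearTwist_shearTwist]; simp [shearTwist]
  right_inv z := by rw [shearTwist_shearTwist]; simp [shearTwist]
  contMDiff_toFun := contMDiff_shearTwist hF
  contMDiff_invFun := contMDiff_shearTwist hF.inv

/-- The underlying map of `shearTwistDiffeo`. [folklore] -/
@[simp] theorem coe_shearTwistDiffeo (F : Circle → Circle) (hF : ContMDiff (𝓡 1) (𝓡 1) ∞ F) :
    ⇑(shearTwistDiffeo F hF) = shearTwist F := rfl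

/-- The inverse of `shearTwistDiffeo`. [folklore] -/
@[simp] theorem coe_shearTwistDiffeo_symm (F : Circle → Circle) (hF : ContMDiff (𝓡 1) (𝓡 1) ∞ F) :
    ⇑(shearTwistDiffeo F hF).symm = shearTwist fun w ↦ (F w)⁻¹ := rfl

variable {a' b' : ℝ} (ha : 0 < a') (hab : a' < b') (hb : b' < π)

/-- **The fishtail monodromy** `Ψ (z₁, z₂, z₃) = (z₁, z₂, z₃ e^{i g(arg z₂)})`, `g = gompfLift a′ b′`
the smooth degree-one staircase stepping across the arc `a′ ≤ arg z₂ ≤ b′`: a Dehn twist of the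
fibre torus `T²_{(z₂, z₃)}` along the circle `{arg z₂ = const ∈ (a′, b′)} × 𝕊¹_{z₃}`, the
identity where `arg z₂ ∉ (a′, b′)`. Its mapping torus is Gompf's `∂Φ` (times the extra circle of
`z₁`): "changing the bundle monodromy … to a Dehn twist `ψ` along `γ`". [cite: GompfAGT2010, Lemma 2.2 (proof: ∂Φ is the T²-bundle with monodromy the Dehn twist ψ along γ)] -/
def fishMonodromy : ThreeTorus ≃ₘ⟮𝓣, 𝓣⟯ ThreeTorus :=
  shearTwistDiffeo (circleMapOfLift (gompfLift a' b'))
    (contMDiff_circleMapOfLift (k := 1) (contDiff_gompfLift ha hab hb)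
      (fun θ ↦ by rw [gompfLift_add_two_pi]; push_cast; ring))

/-- The fishtail monodromy as a map. [folklore] -/
@[simp] theorem coe_fishMonodromy :
    ⇑(fishMonodromy ha hab hb) = shearTwist (circleMapOfLift (gompfLift a' b')) := rfl

/-- The fishtail monodromy on exponentials of the middle coordinate:
`Ψ (z₁, e^{iθ}, z₃) = (z₁, e^{iθ}, z₃ e^{i g θ})`. [folklore] -/
theorem fishMonodromy_apply (z₁ z₃ : Circle) (θ : ℝ) :
    fishMonodromy ha hab hb (z₁, Circle.exp θ, z₃) =
      (z₁, Circle.exp θ, z₃ * Circle.exp (gompfLift a' b' θ)) := by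
  rw [coe_fishMonodromy, shearTwist, circleMapOfLift_exp (k := 1)
    (fun θ ↦ by rw [gompfLift_add_two_pi]; push_cast; ring)]

end Shear

/-! ### The two-step staircase `κ` -/

section Stair

variable {a b : ℝ}

/-- **The two-step staircase** `κ(s) = λ((s - a)/(b - a)) + λ((s - 1 - a)/(b - a))`,
`λ = Real.smoothTransition`: `0` for `s ≤ a`, `1` for `b ≤ s ≤ 1 + a`, `2` for `s ≥ 1 + b`. [folklore] -/
def fishStair (a b s : ℝ) : ℝ :=
  Real.smoothTransition ((s - a) / (b - a)) + Real.smoothTransition ((s - 1 - a) / (b - a))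

/-- The staircase is smooth. [folklore] -/
theorem contDiff_fishStair (a b : ℝ) : ContDiff ℝ ∞ (fishStair a b) :=
  (Real.smoothTransition.contDiff.comp ((contDiff_id.sub contDiff_const).div_const _)).add
    (Real.smoothTransition.contDiff.comp (((contDiff_id.sub contDiff_const).sub contDiff_const).div_const _))

/-- Below the first step the staircase is `0`. [folklore] -/
theorem fishStair_of_le (hab : a < b) {s : ℝ} (hs : s ≤ a) : fishStair a b s = 0 := by
  have h1 : (s - a) / (b - a) ≤ 0 := div_nonpos_of_nonpos_of_nonneg (by linarith) (by linarith)
  have h2 : (s - 1 - a) / (b - a) ≤ 0 := div_nonpos_of_nonpos_of_nonneg (by linarith) (by linarith)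
  rw [fishStair, Real.smoothTransition.zero_of_nonpos h1, Real.smoothTransition.zero_of_nonpos h2,
    add_zero]

/-- Between the steps the staircase is `1`. [folklore] -/
theorem fishStair_of_mem (hab : a < b) {s : ℝ} (h1 : b ≤ s) (h2 : s ≤ 1 + a) : fishStair a b s = 1 := by
  have h1' : 1 ≤ (s - a) / (b - a) := by rw [le_div_iff₀ (by linarith)]; linarith
  have h2' : (s - 1 - a) / (b - a) ≤ 0 := div_nonpos_of_nonpos_of_nonneg (by linarith) (by linarith)
  rw [fishStair, Real.smoothTransition.one_of_one_le h1', Real.smoothTransition.zero_of_nonpos h2',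
    add_zero]

/-- Above the second step the staircase is `2`. [folklore] -/
theorem fishStair_of_ge (hab : a < b) {s : ℝ} (hs : 1 + b ≤ s) : fishStair a b s = 2 := by
  have h1' : 1 ≤ (s - a) / (b - a) := by rw [le_div_iff₀ (by linarith)]; linarith
  have h2' : 1 ≤ (s - 1 - a) / (b - a) := by rw [le_div_iff₀ (by linarith)]; linarith
  rw [fishStair, Real.smoothTransition.one_of_one_le h1', Real.smoothTransition.one_of_one_le h2']
  norm_num

/-- **The staircase gains one unit per turn on the monodromy overlap**: `κ (s + 1) = κ s + 1` for
`b - 1 ≤ s ≤ a + 1/2`… precisely for `0 ≤ s` with `s ≤ 1/2`, given `0 < a < b < 1/2`. [folklore] -/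
theorem fishStair_add_one (ha : 0 < a) (hab : a < b) (hb : b < 1 / 2) {s : ℝ} (hs0 : 0 ≤ s)
    (hs : s ≤ 1 / 2) : fishStair a b (s + 1) = fishStair a b s + 1 := by
  have h1 : 1 ≤ (s + 1 - a) / (b - a) := by rw [le_div_iff₀ (by linarith)]; linarith
  have h2 : (s - 1 - a) / (b - a) ≤ 0 := div_nonpos_of_nonpos_of_nonneg (by linarith) (by linarith)
  rw [fishStair, fishStair, Real.smoothTransition.one_of_one_le h1,
    Real.smoothTransition.zero_of_nonpos h2, show s + 1 - 1 - a = s - a by ring]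
  ring

end Stair

/-! ### The turn of the fibre -/

section Turn

variable {g : ℝ → ℝ} (hg : ContDiff ℝ ∞ g) (hg1 : ∀ θ, g (θ + 2 * π) = g θ + 2 * π)

variable (g) in
/-- The shear lift of the turn: `θ ↦ κ (g(θ + c) - g θ)`, `2π`-periodic for a degree-one `g`. [folklore] -/
def turnLift (κ c : ℝ) (θ : ℝ) : ℝ := κ * (g (θ + c) - g θ)

include hg1 in
/-- The shear lift is `2π`-periodic. [folklore] -/
theorem turnLift_periodic (κ c θ : ℝ) :
    turnLift g κ c (θ + 2 * π) = turnLift g κ c θ + 2 * π * ((0 : ℤ) : ℝ) := by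
  rw [turnLift, turnLift, show θ + 2 * π + c = (θ + c) + 2 * π by ring, hg1, hg1]
  push_cast
  ring

include hg in
/-- The shear lift is jointly smooth in `((κ, c), θ)`. [folklore] -/
theorem contDiff_turnLift_uncurry :
    ContDiff ℝ ∞ (uncurry fun (p : ℝ × ℝ) (θ : ℝ) ↦ turnLift g p.1 p.2 θ) := by
  unfold turnLift
  exact (contDiff_fst.comp contDiff_fst).mul
    ((hg.comp (contDiff_snd.add (contDiff_snd.comp contDiff_fst))).sub (hg.comp contDiff_snd))

/-- **The turn** `F_{κ, c} (z₁, z₂, z₃) = (z₁, z₂ e^{ic}, z₃ e^{i κ (g(arg z₂ + c) - g(arg z₂))})`: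
rotation of Gompf's base circle (the middle coordinate) by `c`, with the shear of the `γ`-circle
that makes the family compatible with the monodromy `Ψ`. Gompf: "the diffeomorphism
`(s, t, x) ↦ (s, s + t, x)`" of the collar of `∂Φ`, read fibrewise in the presentation of `∂Φ` as a
mapping torus over the other base circle. [cite: GompfAGT2010, Lemma 2.2 (proof: the diffeomorphism (s,t,x) ↦ (s,s+t,x) of the collar I × ∂Φ)] -/
def fishTurn (g : ℝ → ℝ) (κ c : ℝ) (z : ThreeTorus) : ThreeTorus :=
  (z.1, z.2.1 * Circle.exp c, z.2.2 * circleMapOfLift (turnLift g κ c) z.2.1)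

include hg1 in
/-- The turn on exponentials of the middle coordinate. [folklore] -/
theorem fishTurn_apply (κ c : ℝ) (z₁ z₃ : Circle) (θ : ℝ) :
    fishTurn g κ c (z₁, Circle.exp θ, z₃) =
      (z₁, Circle.exp (θ + c), z₃ * Circle.exp (κ * (g (θ + c) - g θ))) := by
  rw [fishTurn, circleMapOfLift_exp (k := 0) (turnLift_periodic hg1 κ c), Circle.exp_add]
  rfl

include hg1 in
/-- **The turn by `-c` inverts the turn by `c`.** [folklore] -/
theorem fishTurn_neg_fishTurn (κ c : ℝ) (z : ThreeTorus) :
    fishTurn g κ (-c) (fishTurn g κ c z) = z := by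
  obtain ⟨z₁, z₂, z₃⟩ := z
  obtain ⟨θ, rfl⟩ : ∃ θ : ℝ, Circle.exp θ = z₂ := ⟨arg (z₂ : ℂ), Circle.exp_arg z₂⟩
  rw [fishTurn_apply hg1, fishTurn_apply hg1]
  refine Prod.ext rfl (Prod.ext ?_ ?_)
  · show Circle.exp (θ + c + -c) = Circle.exp θ
    rw [add_neg_cancel_right]
  · show z₃ * Circle.exp (κ * (g (θ + c) - g θ)) * Circle.exp (κ * (g (θ + c + -c) - g (θ + c))) = z₃
    rw [add_neg_cancel_right, mul_assoc, ← Circle.exp_add,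
      show κ * (g (θ + c) - g θ) + κ * (g θ - g (θ + c)) = 0 by ring, Circle.exp_zero, mul_one]

include hg1 in
/-- The turn by `c` inverts the turn by `-c`. [folklore] -/
theorem fishTurn_fishTurn_neg (κ c : ℝ) (z : ThreeTorus) :
    fishTurn g κ c (fishTurn g κ (-c) z) = z := by
  simpa using fishTurn_neg_fishTurn hg1 κ (-c) z

include hg1 in
/-- The turn is injective. [folklore] -/
theorem fishTurn_injective (κ c : ℝ) : Injective (fishTurn g κ c) :=
  (LeftInverse.injective fun z ↦ fishTurn_neg_fishTurn hg1 κ c z)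

include hg1 in
/-- **The turn by `0` is the identity.** [folklore] -/
theorem fishTurn_zero (κ : ℝ) (z : ThreeTorus) : fishTurn g κ 0 z = z := by
  obtain ⟨z₁, z₂, z₃⟩ := z
  obtain ⟨θ, rfl⟩ : ∃ θ : ℝ, Circle.exp θ = z₂ := ⟨arg (z₂ : ℂ), Circle.exp_arg z₂⟩
  rw [fishTurn_apply hg1]
  simp

include hg1 in
/-- **The turn by `2π` is the sliver twist** `(z₁, z₂, z₃) ↦ (z₁, z₂, z₃ e^{2πiκ})` (one full turn
of Gompf's base circle is the Dehn twist `ψ` on the fibre, "namely `ψ` on each fiber"; in the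
present coordinates a rotation of the `γ`-circle by `2πκ`). [cite: GompfAGT2010, Lemma 2.2 (proof: the required diffeomorphism is ψ on each fiber for s = 1 and the identity for s = 0)] -/
theorem fishTurn_two_pi (κ : ℝ) (z : ThreeTorus) :
    fishTurn g κ (2 * π) z = (z.1, z.2.1, z.2.2 * Circle.exp (2 * π * κ)) := by
  obtain ⟨z₁, z₂, z₃⟩ := z
  obtain ⟨θ, rfl⟩ : ∃ θ : ℝ, Circle.exp θ = z₂ := ⟨arg (z₂ : ℂ), Circle.exp_arg z₂⟩
  rw [fishTurn_apply hg1, hg1, Circle.exp_add_two_pi]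
  simp only
  rw [show κ * (g θ + 2 * π - g θ) = 2 * π * κ by ring]

/-- The first coordinate (the depth) is preserved by the turn. [folklore] -/
@[simp] theorem fishTurn_fst (κ c : ℝ) (z : ThreeTorus) : (fishTurn g κ c z).1 = z.1 := rfl

variable {a' b' : ℝ} (ha : 0 < a') (hab : a' < b') (hb : b' < π)

/-- **Compatibility with the monodromy**: `F_{κ+1, c} (Ψ z) = Ψ (F_{κ, c} z)` for `g` the staircase
of `Ψ` — one more unit of shear absorbs the Dehn twist. [cite: GompfAGT2010, Lemma 2.2 (proof: ∂Φ = ℝ × T² / (t, x) ∼ (t − 1, ψ(x)))] -/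
theorem fishTurn_fishMonodromy (κ c : ℝ) (z : ThreeTorus) :
    fishTurn (gompfLift a' b') (κ + 1) c (fishMonodromy ha hab hb z) =
      fishMonodromy ha hab hb (fishTurn (gompfLift a' b') κ c z) := by
  have hg1 : ∀ θ, gompfLift a' b' (θ + 2 * π) = gompfLift a' b' θ + 2 * π := gompfLift_add_two_pi a' b'
  obtain ⟨z₁, z₂, z₃⟩ := z
  obtain ⟨θ, rfl⟩ : ∃ θ : ℝ, Circle.exp θ = z₂ := ⟨arg (z₂ : ℂ), Circle.exp_arg z₂⟩
  rw [fishMonodromy_apply, fishTurn_apply hg1, fishTurn_apply hg1, fishMonodromy_apply]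
  refine Prod.ext rfl (Prod.ext rfl ?_)
  show z₃ * Circle.exp (gompfLift a' b' θ) *
      Circle.exp ((κ + 1) * (gompfLift a' b' (θ + c) - gompfLift a' b' θ)) =
    z₃ * Circle.exp (κ * (gompfLift a' b' (θ + c) - gompfLift a' b' θ)) *
      Circle.exp (gompfLift a' b' (θ + c))
  rw [mul_assoc, mul_assoc, ← Circle.exp_add, ← Circle.exp_add]
  congr 2
  ring

end Turn

/-! ### The re-gluing diffeomorphisms of the two cylinders -/

/-- **Parameters of the fishtail end model**: the base band `[a, b]` of the staircase
(`0 < a < b < 1/2`), the arc `[a′, b′]` of the step of the monodromy lift (`0 < a′ < b′ < π`), and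
the smooth turn profile `u` of the depth coordinate `z₁`. [folklore] -/
structure FishParams where
  /-- Start of the base band. -/
  a : ℝ
  /-- End of the base band. -/
  b : ℝ
  /-- Start of the step of the monodromy lift. -/
  a' : ℝ
  /-- End of the step of the monodromy lift. -/
  b' : ℝ
  ha : 0 < a
  hab : a < b
  hb : b < 1 / 2
  ha' : 0 < a'
  hab' : a' < b'
  hb' : b' < π
  /-- The turn profile of the depth. -/
  u : Circle → ℝ
  hu : ContMDiff (𝓡 1) 𝓘(ℝ, ℝ) ∞ u

namespace FishParams

variable (D : FishParams)

/-- The monodromy lift `g = gompfLift a′ b′`. [folklore] -/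
abbrev lift : ℝ → ℝ := gompfLift D.a' D.b'

/-- The lift is smooth. [folklore] -/
theorem contDiff_lift : ContDiff ℝ ∞ D.lift := contDiff_gompfLift D.ha' D.hab' D.hb'

/-- The lift has degree one. [folklore] -/
theorem lift_add_two_pi (θ : ℝ) : D.lift (θ + 2 * π) = D.lift θ + 2 * π := gompfLift_add_two_pi _ _ θ

/-- The monodromy `Ψ` of the model. [folklore] -/
abbrev monodromy : ThreeTorus ≃ₘ⟮𝓣, 𝓣⟯ ThreeTorus := fishMonodromy D.ha' D.hab' D.hb'

/-- The staircase `κ = fishStair a b`. [folklore] -/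
abbrev stair (s : ℝ) : ℝ := fishStair D.a D.b s

/-- Joint smoothness of `(s, z) ↦ F_{κ(s), t u(z₁)} z` in the base coordinate `s` and the fibre
point `z` (`t = ±1`). [folklore] -/
theorem contMDiff_fishTurn_family (t : ℝ) :
    ContMDiff (𝓘(ℝ, ℝ).prod 𝓣) 𝓣 ∞
      fun q : ℝ × ThreeTorus ↦ fishTurn D.lift (D.stair q.1) (t * D.u q.2.1) q.2 := by
  have hs : ContMDiff (𝓘(ℝ, ℝ).prod 𝓣) 𝓘(ℝ, ℝ) ∞ fun q : ℝ × ThreeTorus ↦ D.stair q.1 :=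
    (contDiff_fishStair D.a D.b).contMDiff.comp contMDiff_fst
  have hc : ContMDiff (𝓘(ℝ, ℝ).prod 𝓣) 𝓘(ℝ, ℝ) ∞ fun q : ℝ × ThreeTorus ↦ t * D.u q.2.1 :=
    contMDiff_const.mul (D.hu.comp (contMDiff_fst.comp contMDiff_snd))
  have h2 : ContMDiff (𝓘(ℝ, ℝ).prod 𝓣) (𝓡 1) ∞ fun q : ℝ × ThreeTorus ↦ q.2.2.1 :=
    contMDiff_fst.comp (contMDiff_snd.comp contMDiff_snd)
  have h3 : ContMDiff (𝓘(ℝ, ℝ).prod 𝓣) (𝓡 1) ∞ fun q : ℝ × ThreeTorus ↦ q.2.2.2 :=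
    contMDiff_snd.comp (contMDiff_snd.comp contMDiff_snd)
  have hexp : ContMDiff (𝓘(ℝ, ℝ).prod 𝓣) (𝓡 1) ∞ fun q : ℝ × ThreeTorus ↦ Circle.exp (t * D.u q.2.1) :=
    contMDiff_circleExp.comp hc
  have hL := contMDiff_circleMapOfLift_param (P := ℝ × ℝ)
    (Φ := fun p θ ↦ turnLift D.lift p.1 p.2 θ) (k := 0) (contDiff_turnLift_uncurry D.contDiff_lift)
    (fun p θ ↦ turnLift_periodic D.lift_add_two_pi p.1 p.2 θ)
  have hpar : ContMDiff (𝓘(ℝ, ℝ).prod 𝓣) (𝓘(ℝ, ℝ × ℝ).prod (𝓡 1)) ∞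
      fun q : ℝ × ThreeTorus ↦ ((D.stair q.1, t * D.u q.2.1), q.2.2.1) :=
    (hs.prodMk_space hc).prodMk h2
  have hshear : ContMDiff (𝓘(ℝ, ℝ).prod 𝓣) (𝓡 1) ∞ fun q : ℝ × ThreeTorus ↦
      circleMapOfLift (turnLift D.lift (D.stair q.1) (t * D.u q.2.1)) q.2.2.1 :=
    hL.comp hpar
  exact (contMDiff_fst.comp contMDiff_snd).prodMk ((h2.mul hexp).prodMk (h3.mul hshear))

/-- **The re-gluing diffeomorphism of the first cylinder** `T³ × (0, 1)`:
`(x, s) ↦ (F_{κ(s), u(x₁)} x, s)`. [folklore] -/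
def twistOne : (ThreeTorus × ↥mappingTorusPieceOne) ≃ₘ⟮ModelWithCorners.prod 𝓣 𝓘(ℝ, ℝ),
    ModelWithCorners.prod 𝓣 𝓘(ℝ, ℝ)⟯ (ThreeTorus × ↥mappingTorusPieceOne) where
  toFun p := (fishTurn D.lift (D.stair p.2) (D.u p.1.1) p.1, p.2)
  invFun p := (fishTurn D.lift (D.stair p.2) (-D.u p.1.1) p.1, p.2)
  left_inv p := by
    show (fishTurn D.lift (D.stair p.2) (-D.u p.1.1) (fishTurn D.lift (D.stair p.2) (D.u p.1.1) p.1), p.2) = p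
    rw [fishTurn_neg_fishTurn D.lift_add_two_pi]
  right_inv p := by
    show (fishTurn D.lift (D.stair p.2) (D.u p.1.1) (fishTurn D.lift (D.stair p.2) (-D.u p.1.1) p.1), p.2) = p
    rw [fishTurn_fishTurn_neg D.lift_add_two_pi]
  contMDiff_toFun := by
    refine ContMDiff.prodMk ?_ contMDiff_snd
    have h := D.contMDiff_fishTurn_family 1
    simp only [one_mul] at h
    exact h.comp ((contMDiff_subtype_val.comp contMDiff_snd).prodMk contMDiff_fst)
  contMDiff_invFun := by
    refine ContMDiff.prodMk ?_ contMDiff_snd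
    have h := D.contMDiff_fishTurn_family (-1)
    simp only [neg_mul, one_mul] at h
    exact h.comp ((contMDiff_subtype_val.comp contMDiff_snd).prodMk contMDiff_fst)

/-- The first re-gluing diffeomorphism as a function. [folklore] -/
@[simp] theorem twistOne_apply (p : ThreeTorus × ↥mappingTorusPieceOne) :
    D.twistOne p = (fishTurn D.lift (D.stair p.2) (D.u p.1.1) p.1, p.2) := rfl

/-- **The re-gluing diffeomorphism of the second cylinder** `T³ × (1/2, 3/2)`:
`(y, t) ↦ (F_{κ(t), u(y₁)} y, t)` (the same formula: the staircase is defined on both cylinders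
and gains one unit per turn). [folklore] -/
def twistTwo : (ThreeTorus × ↥mappingTorusPieceTwo) ≃ₘ⟮ModelWithCorners.prod 𝓣 𝓘(ℝ, ℝ),
    ModelWithCorners.prod 𝓣 𝓘(ℝ, ℝ)⟯ (ThreeTorus × ↥mappingTorusPieceTwo) where
  toFun p := (fishTurn D.lift (D.stair p.2) (D.u p.1.1) p.1, p.2)
  invFun p := (fishTurn D.lift (D.stair p.2) (-D.u p.1.1) p.1, p.2)
  left_inv p := by
    show (fishTurn D.lift (D.stair p.2) (-D.u p.1.1) (fishTurn D.lift (D.stair p.2) (D.u p.1.1) p.1), p.2) = p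
    rw [fishTurn_neg_fishTurn D.lift_add_two_pi]
  right_inv p := by
    show (fishTurn D.lift (D.stair p.2) (D.u p.1.1) (fishTurn D.lift (D.stair p.2) (-D.u p.1.1) p.1), p.2) = p
    rw [fishTurn_fishTurn_neg D.lift_add_two_pi]
  contMDiff_toFun := by
    refine ContMDiff.prodMk ?_ contMDiff_snd
    have h := D.contMDiff_fishTurn_family 1
    simp only [one_mul] at h
    exact h.comp ((contMDiff_subtype_val.comp contMDiff_snd).prodMk contMDiff_fst)
  contMDiff_invFun := by
    refine ContMDiff.prodMk ?_ contMDiff_snd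
    have h := D.contMDiff_fishTurn_family (-1)
    simp only [neg_mul, one_mul] at h
    exact h.comp ((contMDiff_subtype_val.comp contMDiff_snd).prodMk contMDiff_fst)

/-- The second re-gluing diffeomorphism as a function. [folklore] -/
@[simp] theorem twistTwo_apply (p : ThreeTorus × ↥mappingTorusPieceTwo) :
    D.twistTwo p = (fishTurn D.lift (D.stair p.2) (D.u p.1.1) p.1, p.2) := rfl

/-- **The re-gluing diffeomorphisms respect the mapping torus relation**: on the identical overlap
`t = s` trivially, and on the monodromy overlap `t = s + 1` because `κ (s + 1) = κ s + 1` and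
`F_{κ+1} ∘ Ψ = Ψ ∘ F_κ`. [cite: GompfAGT2010, Lemma 2.2 (proof: the diffeomorphism (s,t,x) ↦ (s,s+t,x) is well defined on the collar of ∂Φ)] -/
theorem mappingTorusRel_twist_iff (p : ThreeTorus × ↥mappingTorusPieceOne)
    (q : ThreeTorus × ↥mappingTorusPieceTwo) :
    mappingTorusRel D.monodromy (D.twistOne p) (D.twistTwo q) ↔ mappingTorusRel D.monodromy p q := by
  have hg1 := D.lift_add_two_pi
  obtain ⟨x, s⟩ := p
  obtain ⟨y, t⟩ := q
  simp only [mappingTorusRel, twistOne_apply, twistTwo_apply]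
  refine or_congr ⟨fun ⟨h1, h2⟩ ↦ ⟨h1, ?_⟩, fun ⟨h1, h2⟩ ↦ ⟨h1, ?_⟩⟩
    ⟨fun ⟨h1, h2⟩ ↦ ⟨h1, ?_⟩, fun ⟨h1, h2⟩ ↦ ⟨h1, ?_⟩⟩
  · have hd : y.1 = x.1 := by simpa using congrArg Prod.fst h2
    rw [h1, hd] at h2
    exact fishTurn_injective hg1 _ _ h2
  · rw [h1, h2]
  · have hs0 : 0 ≤ (s : ℝ) := s.2.1.le
    have hs : (s : ℝ) ≤ 1 / 2 := by have := t.2.2; rw [h1] at this; linarith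
    have hd : y.1 = x.1 := by simpa using congrArg Prod.fst h2
    rw [h1, hd, show D.stair ((s : ℝ) + 1) = D.stair s + 1 from
      fishStair_add_one D.ha D.hab D.hb hs0 hs] at h2
    have hfd : (D.monodromy x).1 = x.1 := rfl
    rw [← hfd, ← fishTurn_fishMonodromy D.ha' D.hab' D.hb'] at h2
    exact fishTurn_injective hg1 _ _ h2
  · have hs0 : 0 ≤ (s : ℝ) := s.2.1.le
    have hs : (s : ℝ) ≤ 1 / 2 := by have := t.2.2; rw [h1] at this; linarith
    rw [h1, h2, show D.stair ((s : ℝ) + 1) = D.stair s + 1 from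
      fishStair_add_one D.ha D.hab D.hb hs0 hs]
    exact fishTurn_fishMonodromy D.ha' D.hab' D.hb' _ _ x

/-- **`MTorus Ψ` is an open gluing of the two cylinders along its own relation with the twisted
witnesses** `inl ∘ twistOne`, `inr ∘ twistTwo`. [cite: GompfAGT2010, Lemma 2.2 (proof)] -/
theorem isOpenGluingWith_mTorus_twist :
    IsOpenGluingWith (ModelWithCorners.prod 𝓣 𝓘(ℝ, ℝ)) (ModelWithCorners.prod 𝓣 𝓘(ℝ, ℝ)) (𝓡 4)
      (mappingTorusRel ⇑D.monodromy)
      ((mtGlueData D.monodromy).inl ∘ D.twistOne) ((mtGlueData D.monodromy).inr ∘ D.twistTwo) := by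
  obtain ⟨hA, hAo, hB, hBo, hU, hR⟩ := isOpenGluingWith_mappingTorusGlued D.monodromy linTorusModel
  have hsA : Function.Surjective D.twistOne := D.twistOne.surjective
  have hsB : Function.Surjective D.twistTwo := D.twistTwo.surjective
  refine ⟨hA.comp_diffeomorph _, ?_, hB.comp_diffeomorph _, ?_, ?_, fun p q ↦ ?_⟩
  · rwa [hsA.range_comp]
  · rwa [hsB.range_comp]
  · rwa [hsA.range_comp, hsB.range_comp]
  · rw [Function.comp_apply, Function.comp_apply, hR]
    exact D.mappingTorusRel_twist_iff p q

/-- **Gompf's diffeomorphism of the model end exists**: `R : MTorus Ψ ≅ MTorus Ψ` with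
`R (inl (F p)) = inl p` and `R (inr (F q)) = inr q` (uniqueness of open gluings with witnesses). [cite: GompfAGT2010, Lemma 2.2 (proof: the diffeomorphism extends over Φ)] -/
theorem exists_baseTurn :
    ∃ R : MTorus D.monodromy ≃ₘ⟮𝓡 4, 𝓡 4⟯ MTorus D.monodromy,
      (∀ p, R ((mtGlueData D.monodromy).inl (D.twistOne p)) = (mtGlueData D.monodromy).inl p) ∧
      (∀ q, R ((mtGlueData D.monodromy).inr (D.twistTwo q)) = (mtGlueData D.monodromy).inr q) :=
  D.isOpenGluingWith_mTorus_twist.exists_diffeomorph_apply_eq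
    (isOpenGluingWith_mappingTorusGlued D.monodromy linTorusModel)

/-- **Gompf's diffeomorphism of the model end** (the base turn): the diffeomorphism of `MTorus Ψ`
which on both cylinders is the fibrewise turn `[x, s] ↦ [F_{κ(s), u(x₁)} x, s]` — rotation of
Gompf's base circle by the angle `u` of the depth, sheared to be compatible with the monodromy.
We take the inverse of the diffeomorphism of `exists_baseTurn`, so that `baseTurn` *applies* the
turn. [cite: GompfAGT2010, Lemma 2.2 (proof: (s,t,x) ↦ (s,s+t,x) is the required diffeomorphism for s = 1 and the identity for s = 0)] -/
def baseTurn : MTorus D.monodromy ≃ₘ⟮𝓡 4, 𝓡 4⟯ MTorus D.monodromy :=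
  D.exists_baseTurn.choose.symm

/-- **The base turn on the first cylinder**: `R [x, s] = [F_{κ(s), u(x₁)} x, s]`. [folklore] -/
theorem baseTurn_inl (p : ThreeTorus × ↥mappingTorusPieceOne) :
    D.baseTurn ((mtGlueData D.monodromy).inl p) = (mtGlueData D.monodromy).inl (D.twistOne p) := by
  have h := D.exists_baseTurn.choose_spec.1 p
  rw [baseTurn, ← h, Diffeomorph.symm_apply_apply]

/-- **The base turn on the second cylinder**: `R [y, t] = [F_{κ(t), u(y₁)} y, t]`. [folklore] -/
theorem baseTurn_inr (q : ThreeTorus × ↥mappingTorusPieceTwo) :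
    D.baseTurn ((mtGlueData D.monodromy).inr q) = (mtGlueData D.monodromy).inr (D.twistTwo q) := by
  have h := D.exists_baseTurn.choose_spec.2 q
  rw [baseTurn, ← h, Diffeomorph.symm_apply_apply]

/-- **Where the turn profile vanishes the base turn is the identity** (deep inside `Φ`). [cite: GompfAGT2010, Lemma 2.2 (proof: the identity for s = 0)] -/
theorem baseTurn_inl_of_eq_zero {x : ThreeTorus} (hx : D.u x.1 = 0) (s : ↥mappingTorusPieceOne) :
    D.baseTurn ((mtGlueData D.monodromy).inl (x, s)) = (mtGlueData D.monodromy).inl (x, s) := by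
  rw [baseTurn_inl, twistOne_apply]
  show (mtGlueData D.monodromy).inl (fishTurn D.lift (D.stair s) (D.u x.1) x, s) = _
  rw [hx, fishTurn_zero D.lift_add_two_pi]

/-- Where the turn profile vanishes the base turn is the identity (second cylinder). [folklore] -/
theorem baseTurn_inr_of_eq_zero {y : ThreeTorus} (hy : D.u y.1 = 0) (t : ↥mappingTorusPieceTwo) :
    D.baseTurn ((mtGlueData D.monodromy).inr (y, t)) = (mtGlueData D.monodromy).inr (y, t) := by
  rw [baseTurn_inr, twistTwo_apply]
  show (mtGlueData D.monodromy).inr (fishTurn D.lift (D.stair t) (D.u y.1) y, t) = _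
  rw [hy, fishTurn_zero D.lift_add_two_pi]

/-- **Where the turn profile is `2π` the base turn is the sliver twist**
`[(z₁, z₂, z₃), s] ↦ [(z₁, z₂, z₃ e^{2πiκ(s)}), s]` — the identity except over the base band
`(a, b)` (and its translate in the second cylinder), where it rotates the `γ`-circle once: "`ψ` on
each fiber" for `s = 1`, i.e. regluing by the Dehn twist, here concentrated over the band. [cite: GompfAGT2010, Lemma 2.2 (proof: ψ on each fiber for s = 1) and Thm 2.1 (proof: cut along the front face and reglue by the Dehn twist)] -/
theorem baseTurn_inl_of_eq_two_pi {x : ThreeTorus} (hx : D.u x.1 = 2 * π) (s : ↥mappingTorusPieceOne) :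
    D.baseTurn ((mtGlueData D.monodromy).inl (x, s)) =
      (mtGlueData D.monodromy).inl ((x.1, x.2.1, x.2.2 * Circle.exp (2 * π * D.stair s)), s) := by
  rw [baseTurn_inl, twistOne_apply]
  show (mtGlueData D.monodromy).inl (fishTurn D.lift (D.stair s) (D.u x.1) x, s) = _
  rw [hx, fishTurn_two_pi D.lift_add_two_pi]

/-- Where the turn profile is `2π` the base turn is the sliver twist (second cylinder). [folklore] -/
theorem baseTurn_inr_of_eq_two_pi {y : ThreeTorus} (hy : D.u y.1 = 2 * π) (t : ↥mappingTorusPieceTwo) :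
    D.baseTurn ((mtGlueData D.monodromy).inr (y, t)) =
      (mtGlueData D.monodromy).inr ((y.1, y.2.1, y.2.2 * Circle.exp (2 * π * D.stair t)), t) := by
  rw [baseTurn_inr, twistTwo_apply]
  show (mtGlueData D.monodromy).inr (fishTurn D.lift (D.stair t) (D.u y.1) y, t) = _
  rw [hy, fishTurn_two_pi D.lift_add_two_pi]

/-- **Below the band the sliver twist is trivial**: for `u = 2π` and `s ≤ a` the base turn fixes
`[x, s]`. [folklore] -/
theorem baseTurn_inl_of_eq_two_pi_of_le {x : ThreeTorus} (hx : D.u x.1 = 2 * π)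
    (s : ↥mappingTorusPieceOne) (hs : (s : ℝ) ≤ D.a) :
    D.baseTurn ((mtGlueData D.monodromy).inl (x, s)) = (mtGlueData D.monodromy).inl (x, s) := by
  rw [D.baseTurn_inl_of_eq_two_pi hx, show D.stair s = 0 from fishStair_of_le D.hab hs, mul_zero,
    Circle.exp_zero, mul_one]

/-- **Above the band the sliver twist is trivial as well** (a full rotation): for `u = 2π` and
`b ≤ s` (`s < 1`) the base turn fixes `[x, s]`. [folklore] -/
theorem baseTurn_inl_of_eq_two_pi_of_ge {x : ThreeTorus} (hx : D.u x.1 = 2 * π)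
    (s : ↥mappingTorusPieceOne) (hs : D.b ≤ (s : ℝ)) :
    D.baseTurn ((mtGlueData D.monodromy).inl (x, s)) = (mtGlueData D.monodromy).inl (x, s) := by
  rw [D.baseTurn_inl_of_eq_two_pi hx, show D.stair s = 1 from
    fishStair_of_mem D.hab hs (by have := s.2.2; have := D.ha; linarith), mul_one, Circle.exp_two_pi,
    mul_one]

end FishParams

end Literature.Topology.FourManifolds
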